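import Literature.AlgebraicGeometry.Resolution.RegularLocalRingsQuotient
import Mathlib.RingTheory.HopkinsLevitzki
import Mathlib.RingTheory.Artinian.Ring
import Mathlib.RingTheory.Nakayama
import HarnessLib

/-!
# [OURS · L1 W4.5(b) · EL♮(3)] RING LEMMAS FOR THE ČECH SHADOW: REGULAR-PAIR SWAP MODULO AN IDEAL, DIMENSION DROPS, AND
# «(Ā/(ϖ, f̄) REDUCED ∧ dim Ā ≤ 2) ⟹ Ā/(f̄) REGULAR» (the n = 3 step of (N3) clause (k-iv)′)

Crux chain w45b (cell `res-hironaka`, slot W4.5(b)), working crux **EL♮** = stmt-ResolutionOfSingularities-20038, child **EL♮(3)** =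
stmt-ResolutionOfSingularities-20148, route EquisingularLift, line `sections`; registered stub `stub_elnat_coneTowerPointResolution` @ `ReachTower₄`,
stand-in S6 `hCech`, sub-stand-ins (N3) `hShadow` / (N3′) `hShadowOld`. Written by res-L1-w45b-stub-2 g8. HONEST FRAMING: OURS; NOT a statement of any
manuscript; AI-written, weaker than expert review. No `sorry`; standard axioms; DEF-FREE. `--supports stmt-ResolutionOfSingularities-20148 --as helper`.

WHAT (pure commutative algebra):
* `mul_mem_sup_of_swap` — the regular-pair swap MODULO an ideal `𝔟`: `j` a nonzerodivisor mod `𝔟` and `i` a nonzerodivisor mod `(j) + 𝔟` ⟹ `j` a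
  nonzerodivisor mod `(i) + 𝔟` (used three times at a point of the new exceptional surface: `(ϖ, w, f*)` in all orders);
* `WithBotENat.eq_natCast_pred_of_add_one_eq` — arithmetic in `WithBot ℕ∞`;
* `ringKrullDim_quotient_sup_span_add_one` — `dim S/(J + (x)) + 1 = dim S/J` for `x ∈ 𝔪` a nonzerodivisor modulo the proper ideal `J` of a Noetherian
  local ring (Mathlib `ringKrullDim_quotient_span_singleton_succ_eq_ringKrullDim_of_mem_nonZeroDivisors` in `S/J`);
* `ringKrullDim_quotient_sup_span_le_of_le` — the two-step consequence `dim S/((e) + (κ)) ≤ d − 2` for `dim S ≤ d`, `e ≠ 0` in a domain, `κ` regular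
  mod `e` (feeds the carrier surface `Ā = 𝒪_{X,x}/𝒞_x`, `𝒞_x = (e, κ)`, `dim 𝒪_{X,x} ≤ 4`);
* `maximalIdeal_le_of_isReduced_of_krullDimLE_zero` — a reduced Noetherian local ring of dimension `0` is a field (`𝔪 = ⊥`);
* **`isRegularLocalRing_quotient_span_of_isReduced`** — for a regular local `Ā` of dimension `≤ 2`, `ϖ, f̄ ∈ 𝔪`, `ϖ ≠ 0`, `f̄` a nonzerodivisor
  mod `ϖ`, and `Ā/(ϖ, f̄)` REDUCED: `Ā/(f̄)` is a regular local ring (dimension count ⇒ `Ā/(ϖ,f̄)` Artinian reduced local ⇒ field ⇒ `𝔪 = (ϖ, f̄)`;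
  Nakayama ⇒ `f̄ ∉ 𝔪²`; tree `IsRegularLocalRing.quotient_span_singleton`). This is exactly why (N3)'s conditional-regularity clause holds on the fibre
  lines for `n = 3` (and fails for `n ≥ 4`: `Ā = O⟦x,y⟧`, `f̄ = xy − ϖ²`).

References (index only): [cite: Matsumura1987, Thm. 14.2 and §16]; [cite: StacksProject, Tag 00KH] (Artinian ⟺ Noetherian of dimension 0).
-/

set_option linter.dupNamespace false -- mandated namespace `Summit.<Summit>.<Problem>` of this single-conjunct summit

noncomputable section

open IsLocalRing Literature.AlgebraicGeometry.Resolution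

namespace Summit.ResolutionOfSingularities.ResolutionOfSingularities.Cruxes.EquisingularLiftNat.Sections.CechShadow

universe u

/-! ## The swap modulo an ideal -/

/-- **Swap of a regular pair modulo an ideal.** If `j` is a nonzerodivisor modulo `𝔟` and `i` is a nonzerodivisor modulo `(j) + 𝔟`, then `j` is a
nonzerodivisor modulo `(i) + 𝔟`. [cite: Matsumura1987, §16] -/
theorem mul_mem_sup_of_swap {S : Type u} [CommRing S] (𝔟 : Ideal S) {i j : S} (hj : ∀ b : S, j * b ∈ 𝔟 → b ∈ 𝔟)
    (hij : ∀ a : S, i * a ∈ Ideal.span {j} ⊔ 𝔟 → a ∈ Ideal.span {j} ⊔ 𝔟) (b : S) (hb : j * b ∈ Ideal.span {i} ⊔ 𝔟) :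
    b ∈ Ideal.span {i} ⊔ 𝔟 := by
  obtain ⟨ai, hai, t, ht, hsum⟩ := Submodule.mem_sup.mp hb
  obtain ⟨a, rfl⟩ := Ideal.mem_span_singleton'.mp hai
  -- `i * a ∈ (j) + 𝔟`
  have h1 : i * a ∈ Ideal.span {j} ⊔ 𝔟 := by
    have : i * a = j * b - t := by rw [← hsum]; ring
    rw [this]
    exact Ideal.sub_mem _ (Ideal.mem_sup_left (Ideal.mem_span_singleton'.mpr ⟨b, by ring⟩)) (Ideal.mem_sup_right ht)
  obtain ⟨aj, haj, t', ht', hsum'⟩ := Submodule.mem_sup.mp (hij a h1)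
  obtain ⟨a', rfl⟩ := Ideal.mem_span_singleton'.mp haj
  -- `j * (b - a' * i) ∈ 𝔟`
  have h2 : j * (b - a' * i) ∈ 𝔟 := by
    have : j * (b - a' * i) = t + t' * i := by
      have e1 : a * i = j * b - t := by rw [← hsum]; ring
      have e2 : a = a' * j + t' := hsum'.symm
      rw [e2] at e1
      linear_combination -e1
    rw [this]
    exact Ideal.add_mem _ ht (Ideal.mul_mem_right _ _ ht')
  have h3 : b - a' * i ∈ 𝔟 := hj _ h2
  have h4 : b = a' * i + (b - a' * i) := by ring
  rw [h4]
  exact Ideal.add_mem _ (Ideal.mem_sup_left (Ideal.mem_span_singleton'.mpr ⟨a', rfl⟩)) (Ideal.mem_sup_right h3)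

/-! ## Arithmetic in `WithBot ℕ∞` -/

/-- In `WithBot ℕ∞`: `x + 1 = d + 1` with `d : ℕ` forces `x = d`, and `x + 1 = 0` is impossible unless read through truncated subtraction;
general form `x + 1 = d ⟹ x = d - 1`. [folklore] -/
theorem WithBotENat.eq_natCast_pred_of_add_one_eq {x : WithBot ℕ∞} {d : ℕ} (h : x + 1 = d) : x = (d - 1 : ℕ) := by
  induction x using WithBot.recBotCoe with
  | bot =>
    rw [WithBot.bot_add] at h
    exact absurd h (WithBot.bot_ne_natCast d)
  | coe a =>
    induction a using ENat.recTopCoe with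
    | top =>
      have h' : (⊤ : ℕ∞) + 1 = d := by exact_mod_cast h
      rw [top_add] at h'
      exact absurd h' (ENat.top_ne_coe d)
    | coe m =>
      have h' : m + 1 = d := by exact_mod_cast h
      have hm : m = d - 1 := by omega
      subst hm
      exact_mod_cast rfl

/-! ## Dimension drops -/

/-- **`dim S/(J + (x)) + 1 = dim S/J`** for a Noetherian local ring `S`, a proper ideal `J`, and `x ∈ 𝔪` a nonzerodivisor modulo `J`.
[cite: Matsumura1987, Thm. 14.2] -/
theorem ringKrullDim_quotient_sup_span_add_one {S : Type u} [CommRing S] [IsLocalRing S] [IsNoetherianRing S] (J : Ideal S)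
    (hJ : J ≠ ⊤) (x : S) (hx : x ∈ maximalIdeal S) (hreg : ∀ z : S, x * z ∈ J → z ∈ J) :
    ringKrullDim (S ⧸ (J ⊔ Ideal.span {x})) + 1 = ringKrullDim (S ⧸ J) := by
  haveI : Nontrivial (S ⧸ J) := Ideal.Quotient.nontrivial_iff.mpr hJ
  haveI : IsLocalRing (S ⧸ J) := isLocalRing_quotient hJ
  have hx0 : Ideal.Quotient.mk J x ∈ nonZeroDivisors (S ⧸ J) := by
    refine mem_nonZeroDivisors_iff_right.mpr fun z hz => ?_
    obtain ⟨z, rfl⟩ := Ideal.Quotient.mk_surjective z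
    rw [← map_mul, Ideal.Quotient.eq_zero_iff_mem, mul_comm] at hz
    exact Ideal.Quotient.eq_zero_iff_mem.mpr (hreg z hz)
  have hxm : Ideal.Quotient.mk J x ∈ maximalIdeal (S ⧸ J) := by
    rw [maximalIdeal_quotient_eq_map J]
    exact Ideal.mem_map_of_mem _ hx
  have h := ringKrullDim_quotient_span_singleton_succ_eq_ringKrullDim_of_mem_nonZeroDivisors hx0 hxm
  have e : (S ⧸ J) ⧸ Ideal.span {Ideal.Quotient.mk J x} ≃+* S ⧸ (J ⊔ Ideal.span {x}) := by
    refine (Ideal.quotEquivOfEq ?_).trans (DoubleQuot.quotQuotEquivQuotSup J (Ideal.span {x}))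
    rw [Ideal.map_span, Set.image_singleton]
  rw [ringKrullDim_eq_of_ringEquiv e] at h
  exact h

/-- **Two drops**: in a Noetherian local DOMAIN `S` with `dim S ≤ d`, for `e ∈ 𝔪 ∖ 0` and `κ ∈ 𝔪` a nonzerodivisor modulo `e`:
`dim S/((e) + (κ)) ≤ d − 2`. [cite: Matsumura1987, Thm. 14.2] -/
theorem ringKrullDim_quotient_sup_span_le {S : Type u} [CommRing S] [IsDomain S] [IsLocalRing S] [IsNoetherianRing S] {d : ℕ}
    (hd : ringKrullDim S ≤ d) (e κ : S) (he : e ∈ maximalIdeal S) (he0 : e ≠ 0) (hκ : κ ∈ maximalIdeal S)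
    (hreg : ∀ z : S, κ * z ∈ Ideal.span {e} → z ∈ Ideal.span {e}) :
    ringKrullDim (S ⧸ (Ideal.span {e} ⊔ Ideal.span {κ})) ≤ (d - 2 : ℕ) := by
  obtain ⟨n, hn⟩ := exists_nat_cast_eq_ringKrullDim (R := S)
  have h1 := ringKrullDim_quotient_span_singleton_succ_eq_ringKrullDim_of_mem_nonZeroDivisors (mem_nonZeroDivisors_of_ne_zero he0) he
  rw [hn] at h1
  have h1' := WithBotENat.eq_natCast_pred_of_add_one_eq h1
  have h2 := ringKrullDim_quotient_sup_span_add_one (Ideal.span {e}) (Ideal.span_singleton_ne_top (fun h => (mem_maximalIdeal _).mp he h))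
    κ hκ hreg
  rw [h1'] at h2
  have h2' := WithBotENat.eq_natCast_pred_of_add_one_eq h2
  rw [h2']
  have hnd : n ≤ d := by rw [hn] at hd; exact_mod_cast hd
  exact_mod_cast (show n - 1 - 1 ≤ d - 2 by omega)

/-! ## Reduced of dimension zero ⟹ field; the (k-iv)′ core -/

/-- **A reduced Noetherian local ring of Krull dimension `≤ 0` has `𝔪 = ⊥`** (Artinian local: `𝔪` is nilpotent). [cite: StacksProject, Tag 00KH] -/
theorem maximalIdeal_eq_bot_of_isReduced_of_ringKrullDim_le_zero {S : Type u} [CommRing S] [IsLocalRing S] [IsNoetherianRing S] [IsReduced S]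
    (h0 : ringKrullDim S ≤ 0) : maximalIdeal S = ⊥ := by
  haveI : Ring.KrullDimLE 0 S := Ring.krullDimLE_iff.mpr (by exact_mod_cast h0)
  haveI : IsArtinianRing S := isArtinianRing_iff_isNoetherianRing_krullDimLE_zero.mpr ⟨inferInstance, inferInstance⟩
  obtain ⟨m, hm⟩ := IsArtinianRing.isNilpotent_jacobson_bot (R := S)
  rw [jacobson_eq_maximalIdeal ⊥ bot_ne_top] at hm
  refine le_bot_iff.mp fun s hs => ?_
  have h1 : s ^ m ∈ (maximalIdeal S) ^ m := Ideal.pow_mem_pow hs m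
  rw [hm] at h1
  exact (IsReduced.eq_zero s ⟨m, h1⟩ : s = 0)

/-- **The `n = 3` step of (N3) clause (k-iv)′.** `Ā` regular local with `dim Ā ≤ 2`, `ϖ, f̄ ∈ 𝔪`, `ϖ ≠ 0`, `f̄` a nonzerodivisor modulo `ϖ`, and
`Ā/((ϖ) + (f̄))` reduced ⟹ `(ϖ) + (f̄) = 𝔪`, `f̄ ∉ 𝔪²`, and `Ā/(f̄)` is a regular local ring. [cite: Matsumura1987, Thm. 14.2] [OURS · L1 W4.5b]
((N3) of TOWER₄ S6; NOT a statement of the manuscript.) -/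
theorem isRegularLocalRing_quotient_span_of_isReduced {S : Type u} [CommRing S] [IsRegularLocalRing S] (hd : ringKrullDim S ≤ 2)
    (ϖ f : S) (hϖ : ϖ ∈ maximalIdeal S) (hϖ0 : ϖ ≠ 0) (hf : f ∈ maximalIdeal S)
    (hreg : ∀ z : S, f * z ∈ Ideal.span {ϖ} → z ∈ Ideal.span {ϖ}) [IsReduced (S ⧸ (Ideal.span {ϖ} ⊔ Ideal.span {f}))] :
    Ideal.span {ϖ} ⊔ Ideal.span {f} = maximalIdeal S ∧ f ∉ (maximalIdeal S) ^ 2 ∧ IsRegularLocalRing (S ⧸ Ideal.span {f}) := by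
  haveI := isDomain_of_isRegularLocalRing S
  set 𝔟 := Ideal.span {ϖ} ⊔ Ideal.span {f} with h𝔟
  have h𝔟m : 𝔟 ≤ maximalIdeal S := sup_le ((Ideal.span_singleton_le_iff_mem _).mpr hϖ) ((Ideal.span_singleton_le_iff_mem _).mpr hf)
  have h𝔟top : 𝔟 ≠ ⊤ := fun h => (maximalIdeal.isMaximal S).ne_top (top_le_iff.mp (h ▸ h𝔟m))
  haveI : Nontrivial (S ⧸ 𝔟) := Ideal.Quotient.nontrivial_iff.mpr h𝔟top
  haveI : IsLocalRing (S ⧸ 𝔟) := isLocalRing_quotient h𝔟top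
  -- dimension: `dim S/𝔟 ≤ 0`
  have hdim : ringKrullDim (S ⧸ 𝔟) ≤ 0 := by
    have h := ringKrullDim_quotient_sup_span_le (d := 2) hd ϖ f hϖ hϖ0 hf hreg
    exact h.trans (by exact_mod_cast (Nat.le_refl 0))
  -- `S/𝔟` is a field: `𝔪 ⊆ 𝔟`
  have hmax : maximalIdeal (S ⧸ 𝔟) = ⊥ := maximalIdeal_eq_bot_of_isReduced_of_ringKrullDim_le_zero hdim
  have h𝔪 : 𝔟 = maximalIdeal S := by
    refine le_antisymm h𝔟m fun s hs => ?_
    have h1 : Ideal.Quotient.mk 𝔟 s ∈ maximalIdeal (S ⧸ 𝔟) := by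
      rw [maximalIdeal_quotient_eq_map 𝔟]; exact Ideal.mem_map_of_mem _ hs
    rw [hmax, Ideal.mem_bot, Ideal.Quotient.eq_zero_iff_mem] at h1
    exact h1
  -- `f ∉ 𝔪²` by Nakayama: else `𝔪 = (ϖ) + 𝔪² ⟹ 𝔪 = (ϖ) ∋ f`, contradicting `f` regular mod `ϖ`
  have hf2 : f ∉ (maximalIdeal S) ^ 2 := by
    intro hf2
    have hle : (maximalIdeal S : Submodule S S) ≤ Ideal.span {ϖ} ⊔ maximalIdeal S • maximalIdeal S := by
      rw [Ideal.smul_eq_mul, ← pow_two]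
      conv_lhs => rw [← h𝔪, h𝔟]
      exact sup_le le_sup_left ((Ideal.span_singleton_le_iff_mem _).mpr (Ideal.mem_sup_right hf2))
    have hN := Submodule.le_of_le_smul_of_le_jacobson_bot (IsNoetherian.noetherian _) (le_of_eq (jacobson_eq_maximalIdeal ⊥ bot_ne_top).symm) hle
    have hfϖ : f ∈ Ideal.span {ϖ} := hN hf
    have h1 : (1 : S) ∈ Ideal.span {ϖ} := hreg 1 (by rw [mul_one]; exact hfϖ)
    rw [Ideal.mem_span_singleton] at h1
    exact (mem_maximalIdeal _).mp hϖ (isUnit_of_dvd_one h1)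
  exact ⟨h𝔪, hf2, (IsRegularLocalRing.quotient_span_singleton hf hf2).1⟩

end Summit.ResolutionOfSingularities.ResolutionOfSingularities.Cruxes.EquisingularLiftNat.Sections.CechShadow

end
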